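import Summits.BirchSwinnertonDyer.BirchSwinnertonDyer.Theorems.RamifiedHeegnerPairLeafPartnerGenusLabelB3
import Summits.BirchSwinnertonDyer.Rank1Residual.X11b.KolyvaginRingClassCyclic
import Summits.BirchSwinnertonDyer.Rank1Residual.X11b.KolyvaginTraceRelation
import Literature.NumberTheory.EllipticCurves.KolyvaginHeegnerSystem
import Literature.NumberTheory.Automorphic.ShimuraCurveRibetTakahashiPeterssonTwistDescentProofs
import Literature.NumberTheory.EllipticCurves.LFunctionPrimeCoeff
import HarnessLib

/-!
# Crux U₁ `LeafRankOneUpperAtThree` (stmt-BirchSwinnertonDyer-26022) ∕ U₀ (26024), line `partnerdescent` — partner kernel part 19: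
# label (B4) of the descended family — the NORM RELATION `Σ_{i≤ℓ} σ^i ys(m) = a_ℓ(W) · ys(m/ℓ)↑`

HONEST FRAMING (lead prover `bsd-line-rhp-p2` g58, explicit-unit seat, cell `bsd-wall`): a SUPPORT file (`--supports 26022 --as helper`)
for the registered stub (DISPLAY-L) `stub_partnerGenusDisplayLabelledAtThree`. It proves NO stub and closes NO item; BSD is proved for no
curve. Theorems only; no definition, no named fact, no `sorry`.

WHAT. The (B4) conjunct of `ShimuraWalk.LabelsAt` (Gross Prop. 3.7 (1): `Tr_ℓ ys(m) = a_ℓ · ys(m/ℓ)`) for the re-signed descended family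
`ys(m) = (c·χ(m)) • D_m`, `D_m↑K[3m] = ψ_θ((1 − σ_m)·y(3m))`, from the fact's (B4′) between conductors `3m` and `3(m/ℓ)`. THE MECHANISM:
* §1 `frobeniusTrace_partner` — `a_ℓ(W) = (−3/ℓ)·a_ℓ(V)` at an odd prime `ℓ ≠ 3` good for both (Mathlib's `L`-function coefficients,
  the tree's `LFunction_quadraticTwist_intCast_apply_prime_pow_of_not_dvd`, isomorphism invariance).
* §2 `sum_range_pow_eq_of_zpowers_eq` — the trace `Σ_{i≤ℓ} σ^i P` over a generator of `G_ℓ` does not depend on the generator.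
* §3 `exists_generator_lift` — a generator `σ̃₀` of `Gal(K[3m]/K[3(m/ℓ)])` (cyclic of order `ℓ+1`, tree) FIXES `θ ∈ K[3(m/ℓ)]` and
  RESTRICTS to a generator of `Gal(K[m]/K[m/ℓ])` (the restriction is injective on it: its kernel `{1, σ_m}` meets the `θ`-fixers in `1`).
* §4 `labelB4_of_descents` — upstairs in `W(K[3m])`: `Σ σ̃₀^i ψ_θ z_m = ψ_θ((1 − σ_m) Σ σ̃₀^i y(3m)) = a_ℓ(V)·ψ_θ((1 − σ_m) y(3m/ℓ)↑)`
  ((B4′); `Gal(K[3m]/K)` abelian), `σ_m ∘ ↑ = ↑ ∘ σ_{m/ℓ}` (`res σ_m = σ_{m/ℓ}`: it moves `θ`), `ψ_θ ∘ ↑ = ↑ ∘ ψ_{θ′}`, and the two ways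
  `K[m/ℓ] → K[3m]` agree; downstairs by injectivity: **`Σ_{i≤ℓ} σ^i ((cχ_m) • D_m) = a_ℓ(W) • ((cχ_{m/ℓ}) • D_{m/ℓ})↑`** whenever
  `χ_m = (−3/ℓ)·χ_{m/ℓ}` — VERBATIM the (B4) clause; the sign `(−3/ℓ)` of `a_ℓ(W) = (−3/ℓ)a_ℓ(V)` is absorbed by the re-signing.
[cite: GrossLMS1991, §3 Prop. 3.7 (1) (p. 237), §3 (G_ℓ cyclic of order ℓ+1)] [cite: Nekovar2007, (4.8)] [cite: SilvermanAEC2009, X.2 Prop. 2.4,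
X.5 Cor. 5.4, Exercise 10.16] presearch: as parts 14–18; template bsd-addord `GenusKolyvagin.label_B4_level` (X₀(N), d₁ ∣ d_K); nothing restated.
-/

set_option linter.dupNamespace false
set_option autoImplicit false

noncomputable section

open scoped Classical

namespace Summit.BirchSwinnertonDyer.BirchSwinnertonDyer.Theorems.LeafPartnerGenusLabelB4

open WeierstrassCurve NumberField Literature.NumberTheory.EllipticCurves
  Literature.NumberTheory.EllipticCurves.RingClassField
  Summit.BirchSwinnertonDyer.Rank1Residual.X11b.RingClassTower
  Summit.BirchSwinnertonDyer.BirchSwinnertonDyer.Theorems.LeafPartnerGenusTransport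
  Summit.BirchSwinnertonDyer.BirchSwinnertonDyer.Theorems.LeafPartnerGenusBottom
  Summit.BirchSwinnertonDyer.BirchSwinnertonDyer.Theorems.LeafPartnerGenusLift
  Summit.BirchSwinnertonDyer.BirchSwinnertonDyer.Theorems.LeafPartnerGenusLabelB2
  Summit.BirchSwinnertonDyer.BirchSwinnertonDyer.Theorems.LeafPartnerGenusLabelB3

variable {K : Type} [Field K] [NumberField K]

/-! ## §1 `a_ℓ(W) = (−3/ℓ)·a_ℓ(V)` -/

/-- **`a_ℓ(W) = (−3/ℓ)·a_ℓ(V)`** for globally minimal `W`, `V` with `C • W^{(−3)} = V`, at an odd prime `ℓ ≠ 3` of good reduction for both: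
`a_ℓ(V) = a_ℓ(W^{(−3)}) = (−3/ℓ)a_ℓ(W)` (Mathlib's `L`-function coefficients; `(−3/ℓ)² = 1`). [cite: SilvermanAEC2009, X.2 Prop. 2.4, Exercise 10.16] -/
theorem frobeniusTrace_partner (W : WeierstrassCurve ℚ) [W.IsElliptic] [W.IsGloballyMinimal]
    {V : WeierstrassCurve ℚ} [V.IsElliptic] [V.IsGloballyMinimal] (C : VariableChange ℚ) (hV : C • W.quadraticTwist (-3) = V)
    {ℓ : ℕ} [Fact ℓ.Prime] (hℓ2 : ℓ ≠ 2) (hℓ3 : ℓ ≠ 3)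
    (hgoodW : W.HasGoodReductionAtPrime ℓ) (hgoodV : V.HasGoodReductionAtPrime ℓ) :
    W.frobeniusTrace ℓ = jacobiSym (-3) ℓ * V.frobeniusTrace ℓ := by
  have hℓ : ℓ.Prime := Fact.out
  have hd : (-3 : ℚ) ≠ 0 := by norm_num
  haveI := W.isElliptic_quadraticTwist hd
  obtain ⟨v, hv⟩ : ∃ v : IsDedekindDomain.HeightOneSpectrum (𝓞 ℚ), (Rat.HeightOneSpectrum.primesEquiv v : ℕ) = ℓ :=
    ⟨Rat.HeightOneSpectrum.primesEquiv.symm ⟨ℓ, hℓ⟩, by rw [Equiv.apply_symm_apply]⟩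
  have hℓd : ¬ ((ℓ : ℕ) : ℤ) ∣ (-3 : ℤ) := by
    intro h
    have h3 : (ℓ : ℤ) ∣ 3 := (dvd_neg.mp h)
    have : ℓ ∣ 3 := by exact_mod_cast h3
    exact hℓ3 ((Nat.prime_dvd_prime_iff_eq hℓ Nat.prime_three).mp this)
  have key := W.LFunction_quadraticTwist_intCast_apply_prime_pow_of_not_dvd (-3) v (by rw [hv]; exact hℓ2) (by rw [hv]; exact hℓd) 1
  rw [hv, pow_one, pow_one] at key
  have hVL : V.LFunction ℓ = (W.quadraticTwist ((-3 : ℤ) : ℚ)).LFunction ℓ := by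
    rw [← hV]; push_cast; rw [LFunction_smul]
  have hgcd : Int.gcd (-3) ℓ = 1 := by
    rw [Int.gcd_eq_natAbs]
    simpa using (Nat.coprime_primes Nat.prime_three hℓ).mpr (Ne.symm hℓ3)
  have hJ : jacobiSym (-3) ℓ * jacobiSym (-3) ℓ = 1 := by
    rcases jacobiSym.eq_one_or_neg_one hgcd with h | h <;> rw [h] <;> norm_num
  rw [← LFunction_apply_prime_eq_frobeniusTrace W ℓ hgoodW, ← LFunction_apply_prime_eq_frobeniusTrace V ℓ hgoodV, hVL, key,
    ← mul_assoc, hJ, one_mul]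

/-! ## §2 The trace over `G_ℓ` does not depend on the generator -/

/-- **`Σ_{k<n} f(σ^k) = Σ_{k<n} f(τ^k)` for two generators of the same cyclic group of order `n`** (both are the sum over the group:
`pow_injOn_Iio_orderOf` and `IsOfFinOrder.mem_zpowers_iff_mem_range_orderOf`). [folklore] -/
theorem sum_range_pow_eq_of_zpowers_eq {G : Type*} [Group G] {M : Type*} [AddCommMonoid M] {σ τ : G} {n : ℕ}
    (hσ : orderOf σ = n) (hτ : orderOf τ = n) (hz : Subgroup.zpowers σ = Subgroup.zpowers τ) (f : G → M) :
    ∑ k ∈ Finset.range n, f (σ ^ k) = ∑ k ∈ Finset.range n, f (τ ^ k) := by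
  rcases Nat.eq_zero_or_pos n with rfl | hn
  · simp
  have hσf : IsOfFinOrder σ := orderOf_pos_iff.mp (by omega)
  have hτf : IsOfFinOrder τ := orderOf_pos_iff.mp (by omega)
  have himg : (Finset.range n).image (fun k => σ ^ k) = (Finset.range n).image (fun k => τ ^ k) := by
    ext g
    rw [← hσ, ← hσf.mem_zpowers_iff_mem_range_orderOf, hσ, ← hτ, ← hτf.mem_zpowers_iff_mem_range_orderOf, hz]
  have hinjσ : Set.InjOn (fun k => σ ^ k) ↑(Finset.range n) := by rw [Finset.coe_range, ← hσ]; exact pow_injOn_Iio_orderOf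
  have hinjτ : Set.InjOn (fun k => τ ^ k) ↑(Finset.range n) := by rw [Finset.coe_range, ← hτ]; exact pow_injOn_Iio_orderOf
  rw [← Finset.sum_image hinjσ, ← Finset.sum_image hinjτ, himg]

/-! ## §3 A `θ`-fixing generator of `Gal(K[3m]/K[3(m/ℓ)])` restricting to a generator of `Gal(K[m]/K[m/ℓ])` -/

/-- `ringClassGalOver` is antitone in the fixed level: if `K[d′] ⊆ K[d]` then `Gal(K[n]/K[n] ∩ K[d]) ≤ Gal(K[n]/K[n] ∩ K[d′])`. [folklore] -/
theorem ringClassGalOver_le_of_le (ι : K →+* ℂ) {n d d' : ℕ} (h : ringClassField K ι d' ≤ ringClassField K ι d) :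
    ringClassGalOver ι n d ≤ ringClassGalOver ι n d' := by
  intro g hg
  refine (_root_.mem_fixingSubgroup_iff (M := ringClassField K ι n ≃ₐ[ℚ] ringClassField K ι n)).mpr fun y hy => ?_
  exact (_root_.mem_fixingSubgroup_iff (M := ringClassField K ι n ≃ₐ[ℚ] ringClassField K ι n)).mp hg y (h hy)

/-- **Generator lift.** `K` imaginary quadratic with `d_K < −4`, `m ≥ 1`, an inert prime `ℓ ≠ 3` with `ℓ ∥ m`; the genus involution
`σ_m` at `3m` (`Gal(K[3m]/K[m]) = {1, σ_m}`, `σ_m θ = −θ` for `θ ∈ K[3m]` with `θ² = −3` and `(θ : ℂ) ∈ K[3(m/ℓ)]`); the restriction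
`res : Gal(K[3m]/K) → Aut(K[m])`. THEN some `σ̃₀ ∈ Gal(K[3m]/K)` generates `Gal(K[3m]/K[3(m/ℓ)])`, fixes `θ`, and `res σ̃₀` generates
`Gal(K[m]/K[m/ℓ])` (orders `ℓ+1` on both levels; `res` is injective on `⟨σ̃₀⟩` because its kernel `{1, σ_m}` contains no non-trivial
`θ`-fixer). [cite: GrossLMS1991, §3 (G_ℓ cyclic of order ℓ+1; the tower)] -/
theorem exists_generator_lift (hK : IsImaginaryQuadratic K) (ι : K →+* ℂ) (hD4 : NumberField.discr K < -4) {m ℓ : ℕ} (hm : m ≠ 0)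
    (hℓ : ℓ.Prime) (hℓ3 : ℓ ≠ 3) (hℓm : ℓ ∣ m) (hℓm' : ¬ ℓ ∣ m / ℓ) (hinert : (Ideal.span {(ℓ : 𝓞 K)}).IsPrime)
    (hle' : ringClassField K ι (m / ℓ) ≤ ringClassField K ι (3 * (m / ℓ)))
    {res : ringClassGal ι (3 * m) →* (ringClassField K ι m ≃ₐ[ℚ] ringClassField K ι m)}
    (hres : ∀ (g : ringClassGal ι (3 * m)) (x : ringClassField K ι m) (y : ringClassField K ι (3 * m)),
      (x : ℂ) = (y : ℂ) → ((res g x : ringClassField K ι m) : ℂ) =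
        (((g : ringClassField K ι (3 * m) ≃ₐ[ℚ] ringClassField K ι (3 * m)) y : ringClassField K ι (3 * m)) : ℂ))
    {σ : ringClassField K ι (3 * m) ≃ₐ[ℚ] ringClassField K ι (3 * m)} (htwo : ∀ τ ∈ ringClassGalOver ι (3 * m) m, τ = 1 ∨ τ = σ)
    {θ : ringClassField K ι (3 * m)} (hσθ : σ θ = -θ) (hθ0 : θ ≠ -θ) (hθmem : (θ : ℂ) ∈ ringClassField K ι (3 * (m / ℓ))) :
    ∃ σt : ringClassGal ι (3 * m),
      Subgroup.zpowers (σt : ringClassField K ι (3 * m) ≃ₐ[ℚ] ringClassField K ι (3 * m)) = ringClassGalOver ι (3 * m) (3 * (m / ℓ)) ∧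
      orderOf (σt : ringClassField K ι (3 * m) ≃ₐ[ℚ] ringClassField K ι (3 * m)) = ℓ + 1 ∧
      (σt : ringClassField K ι (3 * m) ≃ₐ[ℚ] ringClassField K ι (3 * m)) θ = θ ∧
      Subgroup.zpowers (res σt) = ringClassGalOver ι m (m / ℓ) ∧ orderOf (res σt) = ℓ + 1 := by
  have hn : 3 * m ≠ 0 := mul_ne_zero three_ne_zero hm
  have hmn : m ∣ 3 * m := dvd_mul_left m 3
  have hdiv : 3 * m / ℓ = 3 * (m / ℓ) := Nat.mul_div_assoc 3 hℓm
  have hℓn : ℓ ∣ 3 * m := hℓm.mul_left 3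
  have hℓn' : ¬ ℓ ∣ 3 * m / ℓ := by
    rw [hdiv]
    intro h
    rcases (Nat.Prime.dvd_mul hℓ).mp h with h3 | h3
    · exact hℓ3 ((Nat.prime_dvd_prime_iff_eq hℓ Nat.prime_three).mp h3)
    · exact hℓm' h3
  -- a generator upstairs (tree: `G_ℓ` is cyclic)
  obtain ⟨σ₀, hσ₀⟩ := exists_zpowers_eq_ringClassGalOver hK ι hn hℓ hℓn hℓn' hinert
  rw [hdiv] at hσ₀
  have hσ₀mem : σ₀ ∈ ringClassGalOver ι (3 * m) (3 * (m / ℓ)) := hσ₀ ▸ Subgroup.mem_zpowers σ₀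
  have hσ₀G : σ₀ ∈ ringClassGal ι (3 * m) := ringClassGalOver_le_ringClassGal ι _ _ hσ₀mem
  have hord₀ : orderOf σ₀ = ℓ + 1 := by
    have h := orderOf_eq_succ_of_zpowers_eq_ringClassGalOver hK ι hℓ hinert hℓn hℓn' hn (Or.inr hD4) (σ := σ₀) (by rw [hdiv]; exact hσ₀)
    exact h
  -- `σ₀` fixes `θ` (it fixes every element of `K[3m]` whose value lies in `K[3(m/ℓ)]`)
  have hσ₀θ : σ₀ θ = θ :=
    (_root_.mem_fixingSubgroup_iff (M := ringClassField K ι (3 * m) ≃ₐ[ℚ] ringClassField K ι (3 * m))).mp hσ₀mem θ hθmem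
  -- powers of `σ₀` fix `θ`; those killed by `res` are trivial
  have hfixpow : ∀ k : ℕ, (σ₀ ^ k) θ = θ := by
    intro k
    induction k with
    | zero => rfl
    | succ k ih => rw [pow_succ, AlgEquiv.mul_apply, hσ₀θ, ih]
  have hker : ∀ k : ℕ, res (⟨σ₀, hσ₀G⟩ ^ k) = 1 → σ₀ ^ k = 1 := by
    intro k hk
    have hmem : ((⟨σ₀, hσ₀G⟩ ^ k : ringClassGal ι (3 * m)) : ringClassField K ι (3 * m) ≃ₐ[ℚ] ringClassField K ι (3 * m)) ∈
        ringClassGalOver ι (3 * m) m :=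
      mem_ringClassGalOver_of_restrictHom_mem ι hres le_rfl _ (by rw [hk]; exact Subgroup.one_mem _)
    have hpow : ((⟨σ₀, hσ₀G⟩ ^ k : ringClassGal ι (3 * m)) : ringClassField K ι (3 * m) ≃ₐ[ℚ] ringClassField K ι (3 * m)) = σ₀ ^ k := by
      simp
    rw [hpow] at hmem
    rcases htwo _ hmem with h | h
    · exact h
    · exfalso
      have hfix := hfixpow k
      rw [h] at hfix
      exact hθ0 (hfix.symm.trans hσθ)
  have hordres : orderOf (res ⟨σ₀, hσ₀G⟩) = ℓ + 1 := by
    rw [← hord₀]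
    refine orderOf_eq_orderOf_iff.mpr fun k => ⟨fun hk => ?_, fun hk => ?_⟩
    · exact hker k (by rw [map_pow]; exact hk)
    · rw [← map_pow]
      have : (⟨σ₀, hσ₀G⟩ : ringClassGal ι (3 * m)) ^ k = 1 := Subtype.ext (by simpa using hk)
      rw [this, map_one]
  -- `res σ₀` lands in `G_ℓ` downstairs and generates it (same order)
  have hresmem : res ⟨σ₀, hσ₀G⟩ ∈ ringClassGalOver ι m (m / ℓ) :=
    restrictHom_mem_ringClassGalOver hK ι hmn hn hres ⟨σ₀, hσ₀G⟩ (ringClassGalOver_le_of_le ι hle' hσ₀mem)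
  have hzp : Subgroup.zpowers (res ⟨σ₀, hσ₀G⟩) = ringClassGalOver ι m (m / ℓ) := by
    have hle1 : Subgroup.zpowers (res ⟨σ₀, hσ₀G⟩) ≤ ringClassGalOver ι m (m / ℓ) := (Subgroup.zpowers_le).mpr hresmem
    have hcard : Nat.card (ringClassGalOver ι m (m / ℓ)) = ℓ + 1 :=
      RingClassField.card_ringClassGalOver_div_eq_succ hK ι hℓ hinert hℓm hℓm' hm (Or.inr hD4)
    haveI : Finite (ringClassGalOver ι m (m / ℓ)) := Nat.finite_of_card_ne_zero (by rw [hcard]; omega)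
    refine Subgroup.eq_of_le_of_card_ge hle1 ?_
    rw [hcard, Nat.card_zpowers, hordres]
  exact ⟨⟨σ₀, hσ₀G⟩, hσ₀, hord₀, hσ₀θ, hzp, hordres⟩

/-! ## §4 Label (B4) at level `m` -/

/-- **`(res g · P)↑ = g · (P↑)`** along `K[m′] ⊆ K[n]` for the restriction `res : Gal(K[n]/K) → Aut(K[m′])` (`m′ ∣ n`) — plain
equivariance of the inclusion (`pointGalHom_restrictHom_map_inclusion` with the identity restriction at the top). [cite: GrossLMS1991, §3 (p. 216)] -/
theorem map_inclusion_pointGalHom_res' (W : WeierstrassCurve ℚ) (hK : IsImaginaryQuadratic K) (ι : K →+* ℂ) {m' n : ℕ}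
    (hm'n : m' ∣ n) (hn : n ≠ 0) (hle : ringClassField K ι m' ≤ ringClassField K ι n)
    {res : ringClassGal ι n →* (ringClassField K ι m' ≃ₐ[ℚ] ringClassField K ι m')}
    (hres : ∀ (g : ringClassGal ι n) (x : ringClassField K ι m') (y : ringClassField K ι n),
      (x : ℂ) = (y : ℂ) → ((res g x : ringClassField K ι m') : ℂ) =
        (((g : ringClassField K ι n ≃ₐ[ℚ] ringClassField K ι n) y : ringClassField K ι n) : ℂ))
    (g : ringClassGal ι n) (P : (W.baseChange (ringClassField K ι m')).toAffine.Point) :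
    Affine.Point.map ((RingClassField.inclusion ι hle).restrictScalars ℚ) (pointGalHom W (ringClassField K ι m') (res g) P) =
      pointGalHom W (ringClassField K ι n) (g : ringClassField K ι n ≃ₐ[ℚ] ringClassField K ι n)
        (Affine.Point.map ((RingClassField.inclusion ι hle).restrictScalars ℚ) P) := by
  letI : Algebra K ℂ := ι.toAlgebra
  have hid : ∀ (g : ringClassGal ι n) (x : ringClassField K ι n) (y : ringClassField K ι n),
      (x : ℂ) = (y : ℂ) → (((ringClassGal ι n).subtype g x : ringClassField K ι n) : ℂ) =
        (((g : ringClassField K ι n ≃ₐ[ℚ] ringClassField K ι n) y : ringClassField K ι n) : ℂ) := by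
    intro g x y hxy
    have : x = y := Subtype.ext hxy
    rw [this]; rfl
  exact (pointGalHom_restrictHom_map_inclusion (W := W) hK ι hm'n (dvd_refl n) hn hle hid hres g P).symm

section B4

variable (W : WeierstrassCurve ℚ) {W₁ : WeierstrassCurve ℚ} [W₁.IsCharNeTwoNF] (C₁ : VariableChange ℚ) (hC₁ : C₁ • W = W₁)
  {V : WeierstrassCurve ℚ} (CV : VariableChange ℚ) (hV : CV • W₁.quadraticTwist (-3) = V)

/-- **`ψ` commutes with the inclusion of ring class fields** (concrete-level bridge to `genusTransport_map_of_eq`): for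
`K[n′] ≤ K[n]`, `θ ∈ K[n]`, `θ′ ∈ K[n′]` the same complex root of `−3`, and `P ∈ V(K[n′])`: `ψ_θ(P↑) = (ψ_{θ′} P)↑`.
[cite: SilvermanAEC2009, X.5 Cor. 5.4 (iii)] -/
theorem genusTransport_map_inclusion (ι : K →+* ℂ) {n n' : ℕ} (hle : ringClassField K ι n' ≤ ringClassField K ι n)
    {θ : ringClassField K ι n} (hθ2 : θ ^ 2 = algebraMap ℚ (ringClassField K ι n) (-3))
    {θ' : ringClassField K ι n'} (hθ'2 : θ' ^ 2 = algebraMap ℚ (ringClassField K ι n') (-3)) (hθθ' : (θ : ℂ) = (θ' : ℂ))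
    (P : (V.baseChange (ringClassField K ι n')).toAffine.Point) :
    genusTransport W C₁ hC₁ CV hV hθ2 (Affine.Point.map ((RingClassField.inclusion ι hle).restrictScalars ℚ) P) =
      Affine.Point.map ((RingClassField.inclusion ι hle).restrictScalars ℚ) (genusTransport W C₁ hC₁ CV hV hθ'2 P) := by
  have hf : ((RingClassField.inclusion ι hle).restrictScalars ℚ) θ' = θ :=
    Subtype.ext (by rw [AlgHom.restrictScalars_apply, RingClassField.coe_inclusion, hθθ'])
  exact (genusTransport_map_of_eq W C₁ hC₁ CV hV hθ'2 hθ2 _ hf P).symm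

set_option maxHeartbeats 800000 in -- four ring class levels `m/ℓ, m, 3(m/ℓ), 3m`: instance synthesis for the inclusions dominates
/-- **Label (B4) for the descended family at level `m`.** Data (see the module docstring): levels `m`, `m/ℓ`, `3m`, `3(m/ℓ)` with their
inclusions, the restrictions `res_m : Gal(K[3m]/K) → Aut(K[m])`, `res₃ : Gal(K[3m]/K) → Aut(K[3(m/ℓ)])`, the genus involutions `σ_m`
(level `3m`) and `σ′` (level `3(m/ℓ)`), `θ ∈ K[3m]` and `θ′ ∈ K[3(m/ℓ)]` the same complex root of `−3`, CM points `y = y(3m)`,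
`y′ = y(3(m/ℓ))` with the fact's (B4′) clause, descents `D` (of `ψ_θ((1 − σ_m)y)`) and `D′` (of `ψ_{θ′}((1 − σ′)y′)`), a generator `σ` of
`Gal(K[m]/K[m/ℓ])`, and scalars with `c_m = χ_ℓ·c_{m/ℓ}`, `a_ℓ(W) = χ_ℓ·a_ℓ(V)`. CONCLUSION:
`Σ_{i≤ℓ} σ^i (c_m • D) = a_ℓ(W) • (c_{m/ℓ} • D′)↑` — the (B4) clause of `ShimuraWalk.LabelsAt` for `ys(m) = c_m • D_m`.
[cite: GrossLMS1991, §3 Prop. 3.7 (1)] [cite: Nekovar2007, (4.8)] [cite: SilvermanAEC2009, X.5 Cor. 5.4 (iii)] -/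
theorem labelB4_of_descents [W.IsElliptic] [W.IsGloballyMinimal] [V.IsElliptic] [V.IsGloballyMinimal]
    (hK : IsImaginaryQuadratic K) (ι : K →+* ℂ) (hD4 : NumberField.discr K < -4) {m ℓ : ℕ} (hm : m ≠ 0)
    [Fact ℓ.Prime] (hℓ3 : ℓ ≠ 3) (hℓm : ℓ ∣ m) (hℓm' : ¬ ℓ ∣ m / ℓ) (hinert : (Ideal.span {(ℓ : 𝓞 K)}).IsPrime)
    (hle : ringClassField K ι m ≤ ringClassField K ι (3 * m))
    (hle' : ringClassField K ι (m / ℓ) ≤ ringClassField K ι (3 * (m / ℓ)))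
    (hle₃ : ringClassField K ι (3 * (m / ℓ)) ≤ ringClassField K ι (3 * m))
    (hdm : ringClassField K ι (m / ℓ) ≤ ringClassField K ι m)
    {resm : ringClassGal ι (3 * m) →* (ringClassField K ι m ≃ₐ[ℚ] ringClassField K ι m)}
    (hresm : ∀ (g : ringClassGal ι (3 * m)) (x : ringClassField K ι m) (y : ringClassField K ι (3 * m)),
      (x : ℂ) = (y : ℂ) → ((resm g x : ringClassField K ι m) : ℂ) =
        (((g : ringClassField K ι (3 * m) ≃ₐ[ℚ] ringClassField K ι (3 * m)) y : ringClassField K ι (3 * m)) : ℂ))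
    {res₃ : ringClassGal ι (3 * m) →* (ringClassField K ι (3 * (m / ℓ)) ≃ₐ[ℚ] ringClassField K ι (3 * (m / ℓ)))}
    (hres₃ : ∀ (g : ringClassGal ι (3 * m)) (x : ringClassField K ι (3 * (m / ℓ))) (y : ringClassField K ι (3 * m)),
      (x : ℂ) = (y : ℂ) → ((res₃ g x : ringClassField K ι (3 * (m / ℓ))) : ℂ) =
        (((g : ringClassField K ι (3 * m) ≃ₐ[ℚ] ringClassField K ι (3 * m)) y : ringClassField K ι (3 * m)) : ℂ))
    {σm : ringClassField K ι (3 * m) ≃ₐ[ℚ] ringClassField K ι (3 * m)} (hσm : σm ∈ ringClassGalOver ι (3 * m) m)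
    (htwom : ∀ τ ∈ ringClassGalOver ι (3 * m) m, τ = 1 ∨ τ = σm)
    {σ' : ringClassField K ι (3 * (m / ℓ)) ≃ₐ[ℚ] ringClassField K ι (3 * (m / ℓ))}
    (htwo' : ∀ τ ∈ ringClassGalOver ι (3 * (m / ℓ)) (m / ℓ), τ = 1 ∨ τ = σ')
    {θ : ringClassField K ι (3 * m)} (hθ2 : θ ^ 2 = algebraMap ℚ (ringClassField K ι (3 * m)) (-3)) (hσmθ : σm θ = -θ)
    {θ' : ringClassField K ι (3 * (m / ℓ))} (hθ'2 : θ' ^ 2 = algebraMap ℚ (ringClassField K ι (3 * (m / ℓ))) (-3))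
    (hθθ' : (θ : ℂ) = (θ' : ℂ))
    (y : (V.baseChange (ringClassField K ι (3 * m))).toAffine.Point) (y' : (V.baseChange (ringClassField K ι (3 * (m / ℓ)))).toAffine.Point)
    (hB4V : ∀ σt : ringClassField K ι (3 * m) ≃ₐ[ℚ] ringClassField K ι (3 * m),
      Subgroup.zpowers σt = ringClassGalOver ι (3 * m) (3 * (m / ℓ)) →
      ∑ i ∈ Finset.range (ℓ + 1), pointGalHom V (ringClassField K ι (3 * m)) (σt ^ i) y =
        V.frobeniusTrace ℓ • Affine.Point.map (W' := V) ((RingClassField.inclusion ι hle₃).restrictScalars ℚ) y')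
    (D : (W.baseChange (ringClassField K ι m)).toAffine.Point)
    (hD : Affine.Point.map ((RingClassField.inclusion ι hle).restrictScalars ℚ) D =
      genusTransport W C₁ hC₁ CV hV hθ2 (y - pointGalHom V (ringClassField K ι (3 * m)) σm y))
    (D' : (W.baseChange (ringClassField K ι (m / ℓ))).toAffine.Point)
    (hD' : Affine.Point.map ((RingClassField.inclusion ι hle').restrictScalars ℚ) D' =
      genusTransport W C₁ hC₁ CV hV hθ'2 (y' - pointGalHom V (ringClassField K ι (3 * (m / ℓ))) σ' y'))
    {σ : ringClassField K ι m ≃ₐ[ℚ] ringClassField K ι m} (hσ : Subgroup.zpowers σ = ringClassGalOver ι m (m / ℓ))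
    (χℓ cm cm' : ℤ) (hχ : cm = χℓ * cm') (haWV : W.frobeniusTrace ℓ = χℓ * V.frobeniusTrace ℓ) :
    ∑ i ∈ Finset.range (ℓ + 1), pointGalHom W (ringClassField K ι m) (σ ^ i) (cm • D) =
      W.frobeniusTrace ℓ • Affine.Point.map ((RingClassField.inclusion ι hdm).restrictScalars ℚ) (cm' • D') := by
  have hℓ : ℓ.Prime := Fact.out
  have hn : 3 * m ≠ 0 := mul_ne_zero three_ne_zero hm
  have hmn : m ∣ 3 * m := dvd_mul_left m 3
  have h3n : 3 * (m / ℓ) ∣ 3 * m := mul_dvd_mul_left 3 (Nat.div_dvd_of_dvd hℓm)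
  have hθ0 : θ ≠ -θ := ne_neg_of_ne_zero (theta_ne_zero hθ2)
  have hθ'0 : θ' ≠ -θ' := ne_neg_of_ne_zero (theta_ne_zero hθ'2)
  have hθmem : (θ : ℂ) ∈ ringClassField K ι (3 * (m / ℓ)) := by rw [hθθ']; exact θ'.2
  have hσmG : σm ∈ ringClassGal ι (3 * m) := ringClassGalOver_le_ringClassGal ι _ _ hσm
  -- §3: a θ-fixing generator upstairs restricting to a generator downstairs
  obtain ⟨σt, hσt, hordt, hσtθ, hσtres, hordres⟩ :=
    exists_generator_lift hK ι hD4 hm hℓ hℓ3 hℓm hℓm' hinert hle' hresm htwom hσmθ hθ0 hθmem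
  -- §2: replace the given generator `σ` by `resm σt`
  have hordσ : orderOf σ = ℓ + 1 := orderOf_eq_succ_of_zpowers_eq_ringClassGalOver hK ι hℓ hinert hℓm hℓm' hm (Or.inr hD4) hσ
  rw [sum_range_pow_eq_of_zpowers_eq hordσ hordres (hσ.trans hσtres.symm) (fun g => pointGalHom W (ringClassField K ι m) g (cm • D))]
  -- read everything in `W(K[3m])`
  apply map_inclusion_injective' W ι hle
  rw [map_sum (Affine.Point.map ((RingClassField.inclusion ι hle).restrictScalars ℚ)),
    map_zsmul (Affine.Point.map ((RingClassField.inclusion ι hle).restrictScalars ℚ))]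
  -- powers of `σt` fix `θ` and commute with `σm`
  have hfixpow : ∀ k : ℕ, ((σt : ringClassField K ι (3 * m) ≃ₐ[ℚ] ringClassField K ι (3 * m)) ^ k) θ = θ := by
    intro k
    induction k with
    | zero => rfl
    | succ k ih => rw [pow_succ, AlgEquiv.mul_apply, hσtθ, ih]
  have hcommk : ∀ k : ℕ, pointGalHom V (ringClassField K ι (3 * m)) ((σt : ringClassField K ι (3 * m) ≃ₐ[ℚ] _) ^ k)
      (pointGalHom V (ringClassField K ι (3 * m)) σm y) =
      pointGalHom V (ringClassField K ι (3 * m)) σm (pointGalHom V (ringClassField K ι (3 * m)) ((σt : _ ≃ₐ[ℚ] _) ^ k) y) := by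
    intro k
    have hkG : ((σt : ringClassField K ι (3 * m) ≃ₐ[ℚ] _) ^ k) ∈ ringClassGal ι (3 * m) := Subgroup.pow_mem _ σt.2 k
    have hc : ((σt : ringClassField K ι (3 * m) ≃ₐ[ℚ] _) ^ k) * σm = σm * ((σt : ringClassField K ι (3 * m) ≃ₐ[ℚ] _) ^ k) :=
      commute_of_mem_ringClassGal hK hn hkG hσmG
    have h1 : ∀ (a b : ringClassField K ι (3 * m) ≃ₐ[ℚ] ringClassField K ι (3 * m)) (P : (V.baseChange (ringClassField K ι (3 * m))).toAffine.Point),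
        pointGalHom V (ringClassField K ι (3 * m)) a (pointGalHom V (ringClassField K ι (3 * m)) b P) =
          pointGalHom V (ringClassField K ι (3 * m)) (a * b) P := fun a b P => by rw [map_mul]; rfl
    rw [h1, h1, hc]
  -- each term upstairs: `(σ₀^i (c•D))↑ = ψ_θ(σt^i (c • z))`
  have hterm : ∀ i ∈ Finset.range (ℓ + 1),
      Affine.Point.map ((RingClassField.inclusion ι hle).restrictScalars ℚ) (pointGalHom W (ringClassField K ι m) ((resm σt) ^ i) (cm • D)) =
        genusTransport W C₁ hC₁ CV hV hθ2 (cm • (pointGalHom V (ringClassField K ι (3 * m)) ((σt : _ ≃ₐ[ℚ] _) ^ i) y -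
          pointGalHom V (ringClassField K ι (3 * m)) σm (pointGalHom V (ringClassField K ι (3 * m)) ((σt : _ ≃ₐ[ℚ] _) ^ i) y))) := by
    intro i _
    have hDc : Affine.Point.map ((RingClassField.inclusion ι hle).restrictScalars ℚ) (cm • D) =
        genusTransport W C₁ hC₁ CV hV hθ2 (cm • (y - pointGalHom V (ringClassField K ι (3 * m)) σm y)) := by
      rw [map_zsmul (Affine.Point.map ((RingClassField.inclusion ι hle).restrictScalars ℚ)) cm D, hD, ← genusTransport_zsmul]
    have h := map_inclusion_pointGalHom_res_eq W C₁ hC₁ CV hV hK ι hm hle hresm hθ2 (σt ^ i) (by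
      show ((σt : ringClassField K ι (3 * m) ≃ₐ[ℚ] _) ^ i) θ = θ
      exact hfixpow i) _ _ hDc
    rw [map_pow] at h
    rw [h]
    congr 1
    show pointGalHom V (ringClassField K ι (3 * m)) ((σt : ringClassField K ι (3 * m) ≃ₐ[ℚ] _) ^ i)
        (cm • (y - pointGalHom V (ringClassField K ι (3 * m)) σm y)) = _
    rw [map_zsmul, map_sub, hcommk]
  rw [Finset.sum_congr rfl hterm, ← genusTransport_sum, ← Finset.smul_sum, Finset.sum_sub_distrib,
    ← map_sum (pointGalHom V (ringClassField K ι (3 * m)) σm), hB4V _ hσt]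
  -- `σm (y′↑) = (σ′ y′)↑`: `res₃ σm = σ′`
  have hres₃σ : res₃ ⟨σm, hσmG⟩ = σ' := by
    have hmem : res₃ ⟨σm, hσmG⟩ ∈ ringClassGalOver ι (3 * (m / ℓ)) (m / ℓ) :=
      restrictHom_mem_ringClassGalOver hK ι h3n hn hres₃ ⟨σm, hσmG⟩ (ringClassGalOver_le_of_le ι hdm hσm)
    rcases htwo' _ hmem with h1 | h1
    · exfalso
      have hval := hres₃ ⟨σm, hσmG⟩ θ' θ hθθ'.symm
      rw [h1, AlgEquiv.one_apply] at hval
      change (θ' : ℂ) = ((σm θ : ringClassField K ι (3 * m)) : ℂ) at hval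
      rw [hσmθ] at hval
      exact hθ'0 (Subtype.ext (by
        calc ((θ' : ringClassField K ι (3 * (m / ℓ))) : ℂ) = ((-θ : ringClassField K ι (3 * m)) : ℂ) := hval
          _ = -((θ : ringClassField K ι (3 * m)) : ℂ) := NegMemClass.coe_neg _
          _ = -((θ' : ringClassField K ι (3 * (m / ℓ))) : ℂ) := by rw [hθθ']
          _ = ((-θ' : ringClassField K ι (3 * (m / ℓ))) : ℂ) := (NegMemClass.coe_neg _).symm))
    · exact h1
  have hσy' := map_inclusion_pointGalHom_res' V hK ι h3n hn hle₃ hres₃ ⟨σm, hσmG⟩ y'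
  rw [hres₃σ] at hσy'
  -- `ψ_θ ∘ ↑ = ↑ ∘ ψ_{θ′}` on `K[3(m/ℓ)] → K[3m]`
  rw [map_zsmul (pointGalHom V (ringClassField K ι (3 * m)) σm), ← smul_sub, ← hσy',
    ← map_sub (Affine.Point.map (W' := V) ((RingClassField.inclusion ι hle₃).restrictScalars ℚ)), smul_smul,
    genusTransport_zsmul, genusTransport_map_inclusion W C₁ hC₁ CV hV ι hle₃ hθ2 hθ'2 hθθ', ← hD',
    map_zsmul (Affine.Point.map ((RingClassField.inclusion ι hdm).restrictScalars ℚ)),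
    map_zsmul (Affine.Point.map ((RingClassField.inclusion ι hle).restrictScalars ℚ)), smul_smul,
    RingClassField.map_inclusion_map_inclusion ι W hle' hle₃ (hdm.trans hle),
    RingClassField.map_inclusion_map_inclusion ι W hdm hle (hdm.trans hle), haWV, hχ]
  congr 1
  ring

end B4

end Summit.BirchSwinnertonDyer.BirchSwinnertonDyer.Theorems.LeafPartnerGenusLabelB4

end
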